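import Summits.ResolutionOfSingularities.ResolutionOfSingularities.Theorems.WeightedInvariantWeightedThesisHypersurfaceChoiceDim
import Literature.AlgebraicGeometry.Resolution.CurveBlowupDeltaDrop
import Literature.AlgebraicGeometry.Resolution.QuasiExcellentSchemes
import HarnessLib

/-!
# The CLASSICAL centre (blow up the reduced singular locus) and curve presentations — RESHAPE 12 objects

Route `ResolutionOfSingularities/WeightedInvariant`, crux `Theses.WeightedInvariant.WeightedThesis`
(stmt-ResolutionOfSingularities-0569), line `datum-glued-split`, lead c10, RESHAPE 12 — objects file.

Lead c9 brought the consumer side of the line to its floor: the crux follows from the choice ladder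
`∀ p prime, ∀ e, Nonempty (HypersurfaceCentreChoiceDim p e)` (and its tower-indexed weakenings) together with
characteristic-`p` Bergh–Rydh, and the bottom rung `e = 0` is proved. RESHAPE 12 inhabits the first
non-trivial rung `e = 1` — integral CURVES on smooth ambients, torus-homogeneously along their cobordant
towers — and does so CLASSICALLY, with no weighted centre and no invariant: the centre of a pair `(Y, X)` is
the Rees algebra of POWERS of the reduced ideal of the (closure of the) singular locus of `V(X)`
(`classicalCentre`). This file posits the objects:

* `singularClosure X` — the closure in `Y` of the image of the non-regular locus of `V(X)` (closed already
  when `Y` is locally of finite type over a field: `isOpen_regularLocus_of_locallyOfFiniteType`);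
* `classicalCentre X` — the Rees algebra `⊕ₙ 𝓘(singularClosure X)ⁿ tⁿ` (all weights `1`), and the
  corresponding pair-indexed centre rule `classicalRule k`;
* `HypersurfacePair.CurvePresentation P` — the SECTOR INVARIANT of the `e = 1` towers: the pair `P = (Y, X)`
  is the pullback, along a smooth `k`-morphism `g : Y → S` to a smooth separated quasi-compact `k`-scheme `S`,
  of a locally principal ideal sheaf `C` with integral subscheme of dimension `≤ 1` (a curve on a smooth
  surface, up to smooth factors: along a cobordant tower of the classical rule the ambient is, locally,
  `(blown-up surface) × 𝔾ₘⁿ`); `CurvePresentation.deltaSum` — the total `δ`-invariant `Σ_c δ(𝒪_{C,c})` of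
  the presenting curve, the termination measure (it drops when the singular points of `C` are blown up:
  `IsBlowup.finsum_pointDelta_lt`);
* `hyp_support_classicalCentre` (registered stub of the line) — the support of the classical centre is the
  singular closure.

Why the classical centre is admissible for the choice door although it is useless in dimension `≥ 2`: the
door asks, on the pairs REACHED from dimension-`e` starts only, for `(iii)` a regular weighted centre — on the
`e = 1` sector the singular locus is a disjoint union of regular codimension-`2` subschemes cut out by two
elements of a regular system of parameters (pulled back from the closed singular points of the presenting
curve); `(ii')` the generic point off the support — the generic point of an integral scheme is regular;
`(H)` homogeneity for every torus grading of every affine chart making `X` homogeneous — the singular locus is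
functorial for SMOOTH morphisms, so lead c8's coaction argument (`centre_isHomogeneous_of_strategy`) applies
verbatim; `(T)` termination — `deltaSum` drops at every step (embedded resolution of curves by blowing up
points, valid in every characteristic; Kollár 2007 §1.4). Proof files: `Theorems/…ClassicalCentre*.lean`.
-/

noncomputable section

open CategoryTheory AlgebraicGeometry TopologicalSpace
open Literature.AlgebraicGeometry.Resolution

set_option linter.dupNamespace false -- mandated namespace of this single-conjunct summit

namespace Summit.ResolutionOfSingularities.ResolutionOfSingularities.Theorems

/-! ## The classical centre -/

/-- **The singular closure of `V(X)` in `Y`**: the closure of the image in `Y` of the set of points of the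
closed subscheme `V(X)` whose local ring is not regular. For `Y` locally of finite type over a field the
non-regular locus is closed (`isOpen_regularLocus_of_locallyOfFiniteType`) and the closed immersion
`V(X) ↪ Y` has closed image, so this is just the singular locus of `V(X)` seen in `Y`; the closure makes the
definition total. [folklore] -/
def singularClosure {Y : Scheme.{0}} (X : Y.IdealSheafData) : Closeds Y :=
  ⟨closure (X.subschemeι '' (Scheme.regularLocus X.subscheme)ᶜ), isClosed_closure⟩

/-- Unfolding `singularClosure`. [folklore] -/
theorem coe_singularClosure {Y : Scheme.{0}} (X : Y.IdealSheafData) :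
    (singularClosure X : Set Y) = closure (X.subschemeι '' (Scheme.regularLocus X.subscheme)ᶜ) :=
  rfl

/-- **The classical centre of `(Y, X)`**: the Rees algebra `⊕ₙ 𝓘ⁿ tⁿ` of powers of the reduced (vanishing)
ideal sheaf `𝓘 = 𝓘(singularClosure X)` of the singular closure — the centre of the classical embedded
resolution of curves (blow up the singular points, all weights `1`; Kollár 2007 §1.4), read as a weighted
centre in Włodarczyk's sense (Lemma 2.1.12 with `w = 1`: `(Jᵃ) = 𝓘ᵃ`). [cite: Kollar2007, §1.4] -/
def classicalCentre {Y : Scheme.{0}} (X : Y.IdealSheafData) : ReesAlgebraData Y where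
  piece n := Scheme.IdealSheafData.vanishingIdeal (singularClosure X) ^ n
  piece_zero := pow_zero _
  piece_mul_le m n := (pow_add _ m n).symm.le

/-- The pieces of the classical centre are the powers of the vanishing ideal of the singular closure.
[folklore] -/
@[simp] theorem classicalCentre_piece {Y : Scheme.{0}} (X : Y.IdealSheafData) (n : ℕ) :
    (classicalCentre X).piece n = Scheme.IdealSheafData.vanishingIdeal (singularClosure X) ^ n :=
  rfl

/-- The degree-`1` piece of the classical centre is the vanishing ideal of the singular closure. [folklore] -/
theorem classicalCentre_piece_one {Y : Scheme.{0}} (X : Y.IdealSheafData) :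
    (classicalCentre X).piece 1 = Scheme.IdealSheafData.vanishingIdeal (singularClosure X) :=
  pow_one _

/-- **The support of the classical centre is the singular closure** (registered stub of line
`datum-glued-split`, RESHAPE 12): `V(⊕ₙ 𝓘ⁿ) = ⋂_{n>0} V(𝓘ⁿ) = V(𝓘) = singularClosure X`. [folklore] -/
theorem hyp_support_classicalCentre : ∀ {Y : AlgebraicGeometry.Scheme.{0}} (X : Y.IdealSheafData), (Summit.ResolutionOfSingularities.ResolutionOfSingularities.Theorems.classicalCentre X).support = (Summit.ResolutionOfSingularities.ResolutionOfSingularities.Theorems.singularClosure X : Set Y) := by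
  intro Y X
  ext y
  rw [ReesAlgebraData.mem_support_iff]
  constructor
  · intro h
    have h1 := h 1 Nat.one_pos
    rw [classicalCentre_piece, pow_one] at h1
    have : y ∈ ((Scheme.IdealSheafData.vanishingIdeal (singularClosure X)).support : Set Y) := h1
    rwa [Scheme.IdealSheafData.coe_support_vanishingIdeal] at this
  · intro hy n hn
    obtain ⟨m, rfl⟩ := Nat.exists_eq_succ_of_ne_zero hn.ne'
    change y ∈ ((Scheme.IdealSheafData.vanishingIdeal (singularClosure X) ^ (m + 1)).support : Set Y)
    rw [Scheme.IdealSheafData.support_pow_succ, Scheme.IdealSheafData.coe_support_vanishingIdeal]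
    exact hy

/-- **The classical centre rule** over the field `k`: the pair-indexed centre rule `(f : Y → Spec k, X) ↦
classicalCentre X` (it ignores the structure morphism), in the shape the choice doors consume. [folklore] -/
abbrev classicalRule (k : Type) [Field k] :
    ∀ ⦃Y : Scheme.{0}⦄, (Y ⟶ Spec (.of k)) → Y.IdealSheafData → ReesAlgebraData Y :=
  fun _ _ X => classicalCentre X

/-- Unfolding `classicalRule`. [folklore] -/
@[simp] theorem classicalRule_apply (k : Type) [Field k] {Y : Scheme.{0}} (f : Y ⟶ Spec (.of k))
    (X : Y.IdealSheafData) : classicalRule k f X = classicalCentre X :=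
  rfl

/-! ## Curve presentations: the sector invariant of the `e = 1` towers -/

namespace HypersurfacePair

variable {k : Type} [Field k]

/-- **Curve presentation of a hypersurface pair.** `P.CurvePresentation`: the pair `P = (Y, X)` over `k` is
PRESENTED by a curve on a smooth ambient — a smooth separated quasi-compact `hS : S → Spec k`, a locally
principal ideal sheaf `C` on `S` whose closed subscheme is integral of dimension `≤ 1`, and a SMOOTH
`k`-morphism `g : Y → S` pulling `C` back to `X`. Every `e = 1` start pair presents itself (`g = 𝟙`); along a
cobordant tower of the classical rule a presentation of `P` yields one of the successor (blow the presenting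
surface up at the singular points of `C`, take the strict transform, map `B₊` down by the universal property
of blowing up) whose curve has smaller total `δ`-invariant. The sector invariant from which `(iii)` and `(T)`
of the `e = 1` rung are read. A type of the line, not a cited statement. [folklore] -/
structure CurvePresentation (P : HypersurfacePair k) : Type 1 where
  /-- the presenting ambient -/
  S : Scheme.{0}
  /-- its structure morphism -/
  hS : S ⟶ Spec (.of k)
  /-- `S` is smooth over `k` … -/
  [smooth : Smooth hS]
  /-- … separated … -/
  [isSeparated : IsSeparated hS]
  /-- … and quasi-compact -/
  [quasiCompact : QuasiCompact hS]
  /-- the ideal sheaf of the presenting curve -/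
  C : S.IdealSheafData
  /-- `C` is locally principal -/
  isLocallyPrincipal : IsLocallyPrincipal C
  /-- `V(C)` is integral … -/
  isIntegral : IsIntegral C.subscheme
  /-- … of dimension at most one -/
  dim_le_one : topologicalKrullDim C.subscheme ≤ 1
  /-- the presenting morphism -/
  g : P.Y ⟶ S
  /-- `g` is smooth -/
  [smooth_g : Smooth g]
  /-- `g` is a `k`-morphism -/
  g_comp : g ≫ hS = P.f
  /-- `X` is the pullback of `C` -/
  comap_eq : C.comap g = P.X

namespace CurvePresentation

variable {P : HypersurfacePair k} (cp : P.CurvePresentation)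

/-- The presenting ambient is smooth over `k` (structure field as an instance). [folklore] -/
instance smooth_hS : Smooth cp.hS := cp.smooth

/-- The presenting ambient is separated over `k` (structure field as an instance). [folklore] -/
instance isSeparated_hS : IsSeparated cp.hS := cp.isSeparated

/-- The presenting ambient is quasi-compact over `k` (structure field as an instance). [folklore] -/
instance quasiCompact_hS : QuasiCompact cp.hS := cp.quasiCompact

/-- The presenting morphism is smooth (structure field as an instance). [folklore] -/
instance smooth_g' : Smooth cp.g := cp.smooth_g

/-- The presenting curve is integral (structure field as an instance). [folklore] -/
instance isIntegral_subscheme : IsIntegral cp.C.subscheme := cp.isIntegral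

/-- **The total `δ`-invariant of the presenting curve**, `Σ_c δ(𝒪_{C,c})` (a finite sum of finite terms for
an integral Noetherian quasi-excellent curve: `finite_support_pointDelta`, `pointDelta_ne_top`; `finsum`
is `0` off finite support). The termination measure of the `e = 1` rung. [cite: Kollar2007, §1.4] -/
def deltaSum : ℕ∞ :=
  ∑ᶠ c : cp.C.subscheme, pointDelta cp.C.subscheme c

/-- Unfolding `deltaSum`. [folklore] -/
theorem deltaSum_def : cp.deltaSum = ∑ᶠ c : cp.C.subscheme, pointDelta cp.C.subscheme c := rfl

end CurvePresentation

/-- **A start pair of dimension `≤ 1` presents itself**: `S = Y`, `C = X`, `g = 𝟙`. [folklore] -/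
def CurvePresentation.self (P : HypersurfacePair k) (hdim : topologicalKrullDim P.X.subscheme ≤ 1) :
    P.CurvePresentation where
  S := P.Y
  hS := P.f
  C := P.X
  isLocallyPrincipal := P.isLocallyPrincipal
  isIntegral := P.isIntegral
  dim_le_one := hdim
  g := 𝟙 P.Y
  g_comp := Category.id_comp _
  comap_eq := Scheme.IdealSheafData.comap_id _

end HypersurfacePair

end Summit.ResolutionOfSingularities.ResolutionOfSingularities.Theorems

end
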